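import Literature.AlgebraicGeometry.Motives.IntegralModelMorphismFibrePoints
import HarnessLib

/-!
# Points of the special fibre of a model morphism over the reduction of a point, and integral points with prescribed specialisation
# ([SerreTate1968] §1; [Hartshorne1977] II.3 Thm. 3.3, II.4.7; [Liu2002] §10.1.3)

Topic `Literature/AlgebraicGeometry/Motives`, namespace `Literature.AlgebraicGeometry.Motives.IntegralModel`.  THEOREMS only (no def, no instance,
no notation, no named fact, no `sorry`).  Cell `hodgecm-mathlib` (D-0151), FLOOR 0, programme F0P5a, crux item stmt-HodgeConjecture-24832 —
layer (L3a) of the (S-γ2) dictionary (F0P5a LEAD WORDS #11/#12, MOD-PLAN L5.5a; desk `F0/P5a/S-gamma2-DESK.v0` §2 (G4)), over ★ p799041 (layer 1).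

DATA as in ★ `IntegralModel.bijective_extendPoint_fibre`: proper models `𝒮`, `𝒯` of `X`, `T` over `𝓞ᵥ`, a model morphism `π : 𝒯.total ⟶ 𝒮.total` with
generic fibre `p : T ⟶ X`, a point `x ∈ X(Ω)`, its integral extension `x̃ = extendPoint R f 𝒮.total (e_𝒮⁻¹ x)` and its specialisation
`x̃_κ := ι_κ ≫ x̃ : Spec κ(R) → 𝒮` (whose `reductionPoint` IS `red_𝒮 x`, ★ `geomReductionMap_def`).

* `map_reductionPoint_eq_geomReductionMap_iff` — a `κ(R)`-point `yκ` of `𝒯` reduces INTO the fibre of `π_v` over `red_𝒮 x` iff `yκ ≫ π = x̃_κ`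
  (★ `reductionPoint_comp` + injectivity ★ `reductionPoint_injective`);
* **`bijective_reductionPoint_fibre`** — `yκ ↦ reductionPoint yκ` is a BIJECTION `{yκ : 𝒯(κ(R)) | yκ ≫ π = x̃_κ} → {z ∈ 𝒯_v(κ̄) | π_v z = red_𝒮 x}`;
* `setOf_reductionPoint_eq_reductionPoint` — for such `yκ`, the integral points `ρ` over `x̃` with `reductionPoint (ι_κ ≫ ρ) = reductionPoint yκ` are
  exactly those with `ι_κ ≫ ρ = yκ` (prescribed specialisation);
* **`ncard_fibre_geomReductionMap_eq_ncard_specialisation`** — with ★ layer 1: `#{y ∈ T(Ω) over x | red_𝒯 y = reductionPoint yκ} =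
  #{ρ : Spec R → 𝒯 | ρ ≫ π = x̃ ∧ ι_κ ≫ ρ = yκ}` — the number the affine∕henselian layer computes as the rank of the local factor at `yκ`.

HC_CM is proved only modulo the 7 printed citations until rung 0 closes; this file is a generic leaf and changes no count.

## References
* [SerreTate1968] J.-P. Serre, J. Tate, *Good reduction of abelian varieties*, Ann. of Math. 88 (1968), §1 (the reduction map).
* [Hartshorne1977] R. Hartshorne, *Algebraic Geometry*, II.3 Thm. 3.3 (fibre products), II.4.7 (valuative criterion).
* [Liu2002] Q. Liu, *Algebraic Geometry and Arithmetic Curves*, §10.1.3 (reduction of points).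
-/

set_option autoImplicit false

noncomputable section

open CategoryTheory AlgebraicGeometry IsDedekindDomain IsDedekindDomain.HeightOneSpectrum
open scoped NumberField
open Literature.NumberTheory.EllipticCurves (genericFibre)
open Literature.NumberTheory.GaloisRepresentations (closureValuationSubring)
open Literature.NumberTheory.DiophantineGeometry

namespace Literature.AlgebraicGeometry.Motives

namespace IntegralModel

variable {K : Type} [Field K] [NumberField K] {v : HeightOneSpectrum (𝓞 K)} {X T : SchemeOver K}

/-- **A `κ(R)`-point of `𝒯` reduces into the fibre of `π_v` over `red_𝒮 x` iff it lies over the specialisation `ι_κ ≫ x̃` of the integral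
extension of `x`** (`red_𝒮 x = reductionPoint (ι_κ ≫ x̃)` by definition; ★ `reductionPoint_comp`, ★ `reductionPoint_injective`).
[cite: SerreTate1968, §1] [cite: Hartshorne1977, II.3 Thm. 3.3 (fibre product, universal property)] -/
theorem map_reductionPoint_eq_geomReductionMap_iff (𝒮 : IntegralModel (valuationSubringAtPrime K v) K X)
    (𝒯 : IntegralModel (valuationSubringAtPrime K v) K T) [IsProper 𝒮.total.hom] (π : 𝒯.total ⟶ 𝒮.total)
    (x : AlgPoints X (AlgebraicClosure (v.adicCompletion K))) (yκ : residueFieldPoints 𝒯.total) :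
    AlgPoints.map ((specialFibreFunctor v).map π) (𝒯.reductionPoint yκ) = 𝒮.geomReductionMap x ↔
      yκ ≫ π = specRingHomι (closureValuationSubring (v.adicCompletion K)) (toClosureValuationSubring v)
          (IsLocalRing.residue (closureValuationSubring (v.adicCompletion K))) ≫
        extendPoint (closureValuationSubring (v.adicCompletion K)) (toClosureValuationSubring v) 𝒮.total (𝒮.modelPointsEquiv.symm x) := by
  rw [← reductionPoint_comp, geomReductionMap_def]
  exact 𝒮.reductionPoint_injective.eq_iff

/-- **The `κ̄(v)`-points of `𝒯_v` over `red_𝒮 x` are the `κ(R)`-points of `𝒯` over `ι_κ ≫ x̃`**: `yκ ↦ reductionPoint yκ` is a bijection between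
the two (★ `reductionPoint_bijective`). [cite: SerreTate1968, §1] [cite: Hartshorne1977, II.3 Thm. 3.3 (fibre product, universal property)] -/
theorem bijective_reductionPoint_fibre (𝒮 : IntegralModel (valuationSubringAtPrime K v) K X)
    (𝒯 : IntegralModel (valuationSubringAtPrime K v) K T) [IsProper 𝒮.total.hom] (π : 𝒯.total ⟶ 𝒮.total)
    (x : AlgPoints X (AlgebraicClosure (v.adicCompletion K))) :
    Function.Bijective (fun yκ : {yκ : residueFieldPoints 𝒯.total //
        yκ ≫ π = specRingHomι (closureValuationSubring (v.adicCompletion K)) (toClosureValuationSubring v)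
            (IsLocalRing.residue (closureValuationSubring (v.adicCompletion K))) ≫
          extendPoint (closureValuationSubring (v.adicCompletion K)) (toClosureValuationSubring v) 𝒮.total (𝒮.modelPointsEquiv.symm x)} =>
      (⟨𝒯.reductionPoint yκ.1, (map_reductionPoint_eq_geomReductionMap_iff 𝒮 𝒯 π x yκ.1).mpr yκ.2⟩ :
        {z : AlgPoints 𝒯.reductionAt (geomResidueField v) // AlgPoints.map ((specialFibreFunctor v).map π) z = 𝒮.geomReductionMap x})) := by
  constructor
  · rintro ⟨y, hy⟩ ⟨y', hy'⟩ h
    exact Subtype.ext (𝒯.reductionPoint_injective (congrArg Subtype.val h))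
  · rintro ⟨z, hz⟩
    obtain ⟨yκ, rfl⟩ := 𝒯.reductionPoint_surjective z
    exact ⟨⟨yκ, (map_reductionPoint_eq_geomReductionMap_iff 𝒮 𝒯 π x yκ).mp hz⟩, rfl⟩

/-- Integral points whose specialisation REDUCES to `reductionPoint yκ` are the integral points with specialisation `yκ`
(★ `reductionPoint_injective`). [cite: Hartshorne1977, II.3 Thm. 3.3 (fibre product, universal property)] -/
theorem setOf_reductionPoint_eq_reductionPoint (𝒮 : IntegralModel (valuationSubringAtPrime K v) K X)
    (𝒯 : IntegralModel (valuationSubringAtPrime K v) K T)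
    (xt : specValuationSubring (closureValuationSubring (v.adicCompletion K)) (toClosureValuationSubring v) ⟶ 𝒮.total)
    (π : 𝒯.total ⟶ 𝒮.total) (yκ : residueFieldPoints 𝒯.total) :
    {ρ : specValuationSubring (closureValuationSubring (v.adicCompletion K)) (toClosureValuationSubring v) ⟶ 𝒯.total |
        ρ ≫ π = xt ∧ 𝒯.reductionPoint (specRingHomι (closureValuationSubring (v.adicCompletion K)) (toClosureValuationSubring v)
          (IsLocalRing.residue (closureValuationSubring (v.adicCompletion K))) ≫ ρ) = 𝒯.reductionPoint yκ} =
      {ρ | ρ ≫ π = xt ∧ specRingHomι (closureValuationSubring (v.adicCompletion K)) (toClosureValuationSubring v)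
          (IsLocalRing.residue (closureValuationSubring (v.adicCompletion K))) ≫ ρ = yκ} := by
  ext ρ
  simp only [Set.mem_setOf_eq, 𝒯.reductionPoint_injective.eq_iff]

/-- **Counting the generic points over `x` with a given reduction = counting integral points over `x̃` with the given specialisation**
(★ layer 1 `ncard_fibre_geomReductionMap_eq` + `setOf_reductionPoint_eq_reductionPoint`): for `yκ : Spec κ(R) → 𝒯`,
`#{y ∈ T(Ω) | p y = x, red_𝒯 y = reductionPoint yκ} = #{ρ : Spec R → 𝒯 | ρ ≫ π = x̃, ι_κ ≫ ρ = yκ}`.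
[cite: SerreTate1968, §1] [cite: Liu2002, §10.1.3] -/
theorem ncard_fibre_geomReductionMap_eq_ncard_specialisation (𝒮 : IntegralModel (valuationSubringAtPrime K v) K X)
    (𝒯 : IntegralModel (valuationSubringAtPrime K v) K T) [IsProper 𝒮.total.hom] [IsProper 𝒯.total.hom]
    (π : 𝒯.total ⟶ 𝒮.total) (p : T ⟶ X)
    (hπp : (genericFibre (valuationSubringAtPrime K v) K).map π ≫ 𝒮.genericIso'.hom = 𝒯.genericIso'.hom ≫ p)
    (x : AlgPoints X (AlgebraicClosure (v.adicCompletion K))) (yκ : residueFieldPoints 𝒯.total) :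
    Set.ncard {y : AlgPoints T (AlgebraicClosure (v.adicCompletion K)) | AlgPoints.map p y = x ∧ 𝒯.geomReductionMap y = 𝒯.reductionPoint yκ} =
      Set.ncard {ρ : specValuationSubring (closureValuationSubring (v.adicCompletion K)) (toClosureValuationSubring v) ⟶ 𝒯.total |
          ρ ≫ π = extendPoint (closureValuationSubring (v.adicCompletion K)) (toClosureValuationSubring v) 𝒮.total (𝒮.modelPointsEquiv.symm x) ∧
          specRingHomι (closureValuationSubring (v.adicCompletion K)) (toClosureValuationSubring v)
            (IsLocalRing.residue (closureValuationSubring (v.adicCompletion K))) ≫ ρ = yκ} := by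
  rw [ncard_fibre_geomReductionMap_eq 𝒮 𝒯 π p hπp x (𝒯.reductionPoint yκ), setOf_reductionPoint_eq_reductionPoint 𝒮 𝒯 _ π yκ]

/-- The total count over `x`: `#{y ∈ T(Ω) | p y = x} = #{ρ : Spec R → 𝒯 | ρ ≫ π = x̃}` (★ layer 1 `bijective_extendPoint_fibre`).
[cite: Hartshorne1977, II.4.7] [cite: Liu2002, §10.1.3] -/
theorem ncard_fibre_eq_ncard_integralPoints (𝒮 : IntegralModel (valuationSubringAtPrime K v) K X)
    (𝒯 : IntegralModel (valuationSubringAtPrime K v) K T) [IsProper 𝒮.total.hom] [IsProper 𝒯.total.hom]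
    (π : 𝒯.total ⟶ 𝒮.total) (p : T ⟶ X)
    (hπp : (genericFibre (valuationSubringAtPrime K v) K).map π ≫ 𝒮.genericIso'.hom = 𝒯.genericIso'.hom ≫ p)
    (x : AlgPoints X (AlgebraicClosure (v.adicCompletion K))) :
    Nat.card {y : AlgPoints T (AlgebraicClosure (v.adicCompletion K)) // AlgPoints.map p y = x} =
      Nat.card {ρ : specValuationSubring (closureValuationSubring (v.adicCompletion K)) (toClosureValuationSubring v) ⟶ 𝒯.total //
          ρ ≫ π = extendPoint (closureValuationSubring (v.adicCompletion K)) (toClosureValuationSubring v) 𝒮.total (𝒮.modelPointsEquiv.symm x)} :=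
  Nat.card_eq_of_bijective _ (bijective_extendPoint_fibre 𝒮 𝒯 π p hπp x)

end IntegralModel

end Literature.AlgebraicGeometry.Motives

end
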